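import Summits.BirchSwinnertonDyer.Rank1Residual.X2.LocalInertiaTateQuotient
import Literature.NumberTheory.GaloisRepresentations.FrobeniusPrimeToPPart
import Literature.NumberTheory.EllipticCurves.ZpCorankQuasiIso
import HarnessLib

/-!
# `#H¹(I_v, A)[p] ≤ #(A/C)[p]` and the vanishing of Frobenius-invariant `p`-torsion classes for a
# Tate-shaped inertia module (abstract local form of GV Prop. (2.4) at a multiplicative place)

HONEST FRAMING (cell `b2b-bsdres`, run/shared/lean/b2b/bsd-rank1-residual/, verbatim in every
file): the goal of the cell is to DELETE the COMBINATION-SHAPED residual classes of the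
Birch–Swinnerton-Dyer formula for ALL analytic-rank `≤ 1` elliptic curves over `ℚ` — "full BSD
formula for every rank `≤ 1` curve in class `C`" assembled STRICTLY from published theorems — so
that the rank-`≤ 1` remainder becomes exactly the CONSTRUCTION-SHAPED classes, which are TYPED
(missing-input `Prop`s), NOT attempted. This is not "finishing BSD". Sub-cell
`b2b-bsdres-eisenstein-p2` (CLASS-OWNERS row "X2"), gen 29, programme P1 (the UPPER HALF of
Greenberg–Vatsal Cor. (2.3)/Prop. (2.4) in the kernel, X2-GAP §34): research route; NO CLAIM BEYOND
STATED CLASSES; nothing here changes a label. Theorems only; axioms standard; no `sorry`.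

Sequel of `LocalInertiaTateQuotient` (`H¹(I_F, A) ↪ H¹(I_F, A/C)` for a Tate-shaped inertia module:
`A` discrete `p`-primary `p`-divisible, `C ≤ A` `Γ_F`-stable `p`-divisible with `#C[p] ≤ p`, `I_F`
trivial on `C` and `A/C` but not on `A`, `p ≠` residue characteristic). Here:

* §3 `natCard_torsionBy_eq_mul` — `#A[p] = #C[p] · #(A/C)[p]` for `p`-divisible `C`;
  **`natCard_torsionBy_H1_absInertia_le`: `#H¹(I_F, A)[p] ≤ #(A/C)[p]`**
  (`natCard_torsionBy_continuousCohomology_one_absInertia_le` for `A/C`, on which `I_F` acts trivially);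
* §4 **`oneCocycleClass_eq_zero_of_conj`**: if `g ∈ Γ_F` is a prime-to-`p` part of a Frobenius
  (`FrobeniusPrimeToPPart`: a cluster point of `φ^{p^{k!}}`) acting on `(A/C)[p]` as the scalar `a`,
  and `p ∤ q_F − a`, then every `p`-torsion class of `H¹(I_F, A)` represented by a cocycle `f` with
  `g•f(g⁻¹σg) − f(σ)` principal (e.g. the restriction of a cocycle of a subgroup containing `g`) is
  ZERO: its image `f̄ : I_F → (A/C)[p]` satisfies `f̄(gτg⁻¹) = a•f̄(τ) = q•f̄(τ)`.
For `A = E[p^∞]` at a multiplicative `ℓ ≠ p` (`C = Φ(μ_{p^∞})`, `a = a_ℓ = ±1`) these are the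
inertia-level inputs of GV §2 Prop. (2.4) (`corank 𝓗_ℓ(ℚ_∞) = s_ℓ d_ℓ`, `d_ℓ = [ℓ ≡ a_ℓ (mod p)]`)
in the upper-bound direction: `≤ s_ℓ` always, `= 0` when `ℓ ≢ a_ℓ`.

References: Greenberg–Vatsal, Invent. Math. 142 (2000) §2 pp. 14–15, Prop. (2.4) pp. 22–23;
R. Greenberg, Adv. Stud. Pure Math. 17 (1989) §2 Prop. 2; Serre, Invent. Math. 15 (1972) §1.8.
-/

set_option autoImplicit false

noncomputable section

open scoped Classical

open CategoryTheory Function Filter Field ValuativeRel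
open Literature.NumberTheory.GaloisRepresentations Literature.NumberTheory.EllipticCurves
  Literature.NumberTheory.GaloisRepresentations.IsNonarchimedeanLocalField

universe u

namespace Summit.BirchSwinnertonDyer.Rank1Residual.X2.LocalInertiaTateQuotient

section Abstract

variable (F : Type u) [Field F] [ValuativeRel F] [TopologicalSpace F] [IsNonarchimedeanLocalField F]
variable {A : Type u} [AddCommGroup A] [TopologicalSpace A] [DiscreteTopology A]
variable (ρ : ContinuousRep (absoluteGaloisGroup F) ℤ A) (C : Submodule ℤ A)

/-! ## §3. `#H¹(I, A)[p] ≤ #(A/C)[p]` -/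

omit [TopologicalSpace A] [DiscreteTopology A] in
/-- `#A[p] = #C[p] · #(A/C)[p]` when `C ≤ A` is `p`-divisible: `A[p] → (A/C)[p]` is onto (lift,
then correct by an element of `C` with the same `p`-multiple) with kernel `C[p]`. [folklore] -/
theorem natCard_torsionBy_eq_mul (p : ℕ) (hCdiv : ∀ c ∈ C, ∃ c' ∈ C, p • c' = c) :
    Nat.card (Submodule.torsionBy ℤ A (p : ℤ)) =
      Nat.card (Submodule.torsionBy ℤ C (p : ℤ)) * Nat.card (Submodule.torsionBy ℤ (A ⧸ C) (p : ℤ)) := by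
  -- the map `A[p] → (A/C)[p]`
  let π : Submodule.torsionBy ℤ A (p : ℤ) →+ Submodule.torsionBy ℤ (A ⧸ C) (p : ℤ) :=
    { toFun := fun a => ⟨C.mkQ (a : A), by
        rw [Submodule.mem_torsionBy_iff, ← map_smul, (Submodule.mem_torsionBy_iff _ _).1 a.2, map_zero]⟩
      map_zero' := Subtype.ext (by simp)
      map_add' := fun a b => Subtype.ext (by simp) }
  have hπ : ∀ a, ((π a : Submodule.torsionBy ℤ (A ⧸ C) (p : ℤ)) : A ⧸ C) = C.mkQ (a : A) :=
    fun _ => rfl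
  rw [natCard_eq_card_ker_mul_card_range π]
  congr 1
  · -- `ker π ≃ C[p]`
    refine Nat.card_congr
      { toFun := fun a => ⟨⟨((a : Submodule.torsionBy ℤ A (p : ℤ)) : A), ?_⟩, ?_⟩
        invFun := fun c => ⟨⟨((c : C) : A), ?_⟩, ?_⟩
        left_inv := fun a => Subtype.ext (Subtype.ext rfl)
        right_inv := fun c => Subtype.ext (Subtype.ext rfl) }
    · have h := a.2
      rw [AddMonoidHom.mem_ker] at h
      have h' := congrArg (fun x : Submodule.torsionBy ℤ (A ⧸ C) (p : ℤ) => (x : A ⧸ C)) h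
      simp only [hπ, ZeroMemClass.coe_zero] at h'
      have h'' := (LinearMap.mem_ker (f := C.mkQ)).2 h'
      rwa [Submodule.ker_mkQ] at h''
    · have h := (Submodule.mem_torsionBy_iff _ _).1 (a : Submodule.torsionBy ℤ A (p : ℤ)).2
      rw [Submodule.mem_torsionBy_iff]
      exact Subtype.ext (by rw [Submodule.coe_smul]; exact h)
    · have h := (Submodule.mem_torsionBy_iff _ _).1 c.2
      rw [Submodule.mem_torsionBy_iff, ← Submodule.coe_smul, h, Submodule.coe_zero]
    · rw [AddMonoidHom.mem_ker]
      apply Subtype.ext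
      rw [hπ]
      exact (LinearMap.mem_ker).1 (by rw [Submodule.ker_mkQ]; exact (c : C).2)
  · -- `π` is onto
    rw [AddMonoidHom.range_eq_top.2 ?_, AddSubgroup.card_top]
    intro d
    obtain ⟨a, ha⟩ := Submodule.mkQ_surjective C ((d : Submodule.torsionBy ℤ (A ⧸ C) (p : ℤ)) : A ⧸ C)
    have hpa : (p : ℤ) • a ∈ C := by
      rw [← Submodule.ker_mkQ C, LinearMap.mem_ker, map_smul, ha]
      exact (Submodule.mem_torsionBy_iff _ _).1 d.2
    obtain ⟨c, hcC, hc⟩ := hCdiv _ hpa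
    refine ⟨⟨a - c, ?_⟩, Subtype.ext ?_⟩
    · rw [Submodule.mem_torsionBy_iff, smul_sub, sub_eq_zero, ← hc, Nat.cast_smul_eq_nsmul]
    · rw [hπ]
      change C.mkQ (a - c) = (d : A ⧸ C)
      have hc0 : C.mkQ c = 0 := (LinearMap.mem_ker).1 (by rw [Submodule.ker_mkQ]; exact hcC)
      rw [map_sub, hc0, sub_zero]
      exact ha

/-- **`#H¹(I_F, A)[p] ≤ #(A/C)[p]`** for a Tate-shaped inertia module (hypotheses of
`cohomologyMap_mkQHom_one_injective`, plus `(A/C)[p]` finite): `H¹(I, A)[p] ↪ H¹(I, A/C)[p]` (§2) and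
`#H¹(I, A/C)[p] ≤ #((A/C)[p])^{I} = #(A/C)[p]` (`natCard_torsionBy_continuousCohomology_one_absInertia_le`,
`I` acting trivially on `A/C`). For `E[p^∞]` at a multiplicative `v ∤ p` this is `#H¹(I_v, E[p^∞])[p] ≤ p`,
the inertia side of "`𝓗_ℓ(ℚ_∞)` has corank `s_ℓ d_ℓ ≤ s_ℓ`".
[cite: GreenbergVatsal2000, §2 Prop. (2.4) p. 22] [cite: Greenberg1989, §2 Prop. 2] -/
theorem natCard_torsionBy_H1_absInertia_le (hC : ∀ g : absoluteGaloisGroup F, C ≤ C.comap (ρ g)) {p : ℕ} [hp : Fact p.Prime]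
    (hpF : p.Coprime (ringChar 𝓀[F]))
    (hCtriv : ∀ σ ∈ absInertia F, ∀ c ∈ C, ρ σ c = c)
    (hDtriv : ∀ σ ∈ absInertia F, ∀ a : A, ρ σ a - a ∈ C)
    (hCdiv : ∀ c ∈ C, ∃ c' ∈ C, p • c' = c)
    (hAdiv : ∀ a : A, ∃ b : A, p • b = a)
    (hAprim : ∀ a : A, ∃ n : ℕ, p ^ n • a = 0)
    [Finite (Submodule.torsionBy ℤ A (p : ℤ))] [Finite (Submodule.torsionBy ℤ (A ⧸ C) (p : ℤ))]
    (hCp : Nat.card (Submodule.torsionBy ℤ C (p : ℤ)) ≤ p)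
    (hmove : ∃ σ ∈ absInertia F, ∃ a : A, ρ σ a ≠ a) :
    Nat.card (Submodule.torsionBy ℤ
        (continuousCohomology 1 (ρ.restrict (subgroupIncl (absInertia F))).toTopRep) (p : ℤ)) ≤
      Nat.card (Submodule.torsionBy ℤ (A ⧸ C) (p : ℤ)) := by
  haveI : CompactSpace (absoluteGaloisGroup F) := absoluteGaloisGroup_compactSpace F
  haveI : CompactSpace (absInertia F) :=
    isCompact_iff_compactSpace.mp (isClosed_absInertia_holds F).isCompact
  set ρI := ρ.restrict (subgroupIncl (absInertia F)) with hρI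
  have hCI : ∀ g : absInertia F, C ≤ C.comap (ρI g) := fun g => hC g.1
  have hinj := cohomologyMap_mkQHom_one_injective F ρ C hC hpF hCtriv hDtriv hCdiv hAdiv hAprim hCp hmove
  -- the quotient representation over `Γ_F` and its restriction
  set ρD : ContinuousRep (absoluteGaloisGroup F) ℤ (A ⧸ C) := ρ.quotient C hC with hρD
  have hrepD : ρD.restrict (subgroupIncl (absInertia F)) = ρI.quotient C hCI := rfl
  have hDdiv : ∀ d : A ⧸ C, ∃ d' : A ⧸ C, p • d' = d := fun d => by
    obtain ⟨a, rfl⟩ := Submodule.mkQ_surjective C d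
    obtain ⟨b, hb⟩ := hAdiv a
    exact ⟨C.mkQ b, by rw [← map_nsmul, hb]⟩
  have hbound := natCard_torsionBy_continuousCohomology_one_absInertia_le F ρD hpF hDdiv
  have hfin := finite_torsionBy_continuousCohomology_one_absInertia F ρD hpF hDdiv
  rw [hrepD] at hbound hfin
  -- `H¹(I, A)[p] ↪ H¹(I, A/C)[p]`
  let j : Submodule.torsionBy ℤ (continuousCohomology 1 ρI.toTopRep) (p : ℤ) →
      Submodule.torsionBy ℤ (continuousCohomology 1 (ρI.quotient C hCI).toTopRep) (p : ℤ) :=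
    fun x => ⟨cohomologyMap (ρI.mkQHom C hCI) 1 (x : continuousCohomology 1 ρI.toTopRep), by
      have hx := (Submodule.mem_torsionBy_iff _ _).1 x.2
      rw [Nat.cast_smul_eq_nsmul] at hx
      rw [Submodule.mem_torsionBy_iff, Nat.cast_smul_eq_nsmul, ← map_nsmul, hx, map_zero]⟩
  have hj : Injective j := fun x y hxy => Subtype.ext (hinj (congrArg Subtype.val hxy))
  refine (@Nat.card_le_card_of_injective _ _ hfin j hj).trans (hbound.trans ?_)
  exact Nat.card_le_card_of_injective _ Subtype.val_injective

/-! ## §4. Classes invariant under the prime-to-`p` part of a Frobenius -/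

/-- A finite abelian group killed by `p` has order prime to every prime `ℓ ≠ p` (Cauchy).
[folklore] -/
private theorem natCard_coprime_of_prime_nsmul_eq_zero {B : Type*} [AddCommGroup B] [Finite B]
    {p ℓ : ℕ} (hℓ : ℓ.Prime) (hpl : p.Coprime ℓ) (hB : ∀ b : B, p • b = 0) :
    (Nat.card B).Coprime ℓ := by
  rw [Nat.Coprime, Nat.gcd_comm]
  refine Nat.coprime_of_dvd fun r hr hrℓ hrB => ?_
  have hr' : r = ℓ := (Nat.prime_dvd_prime_iff_eq hr hℓ).mp hrℓ
  subst hr'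
  haveI : Fact r.Prime := ⟨hr⟩
  obtain ⟨b, hb⟩ := exists_prime_addOrderOf_dvd_card' (G := B) r hrB
  have hdvd : r ∣ p := by
    rw [← hb]
    exact addOrderOf_dvd_of_nsmul_eq_zero (hB b)
  have h1 : r ∣ Nat.gcd p r := Nat.dvd_gcd hdvd dvd_rfl
  rw [hpl] at h1
  exact hr.one_lt.ne' (Nat.dvd_one.mp h1)

/-- **A `p`-torsion class of `H¹(I_F, A)` invariant under the prime-to-`p` part `g` of a Frobenius
vanishes when `p ∤ q_F − a`**, `a` being the scalar by which `g` acts on `(A/C)[p]`. Precisely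
(hypotheses of `cohomologyMap_mkQHom_one_injective`): let `φ` be a Frobenius (`IsFrobPow φ 1`), `g`
a cluster point of `φ^{p^{k!}}` (`FrobeniusPrimeToPPart`), `ρ̄(g) = a` on `(A/C)[p]`, and `f` a
continuous cocycle of `I_F` in `A` with `p·[f] = 0` and `g•f(g⁻¹σg) − f(σ)` principal — e.g. the
restriction of a cocycle of a subgroup of `Γ_F` containing `I_F` and `g`. Then `[f] = 0`: its image
`f̄ : I_F → (A/C)[p]` is a homomorphism (`I_F` acts trivially on `A/C`) with `f̄(gτg⁻¹) = q•f̄(τ)`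
(`apply_conj_eq_card_nsmul_of_mapClusterPt`) and `= ρ̄(g) f̄(τ) = a•f̄(τ)` (invariance), so
`(q − a) f̄ = 0 = p f̄`, `f̄ = 0`, and §2 applies. For `E[p^∞]` at a multiplicative `ℓ ≠ p` with
`a = a_ℓ = ±1`: the case `d_ℓ = 0` ("`ℓ ≢ a_ℓ (mod p)`") of GV Prop. (2.4).
[cite: GreenbergVatsal2000, §2 Prop. (2.4) pp. 22–23] [cite: Greenberg1989, §2 Prop. 2] -/
theorem oneCocycleClass_eq_zero_of_conj (hC : ∀ g : absoluteGaloisGroup F, C ≤ C.comap (ρ g)) {p : ℕ} [hp : Fact p.Prime]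
    (hpF : p.Coprime (ringChar 𝓀[F]))
    (hCtriv : ∀ σ ∈ absInertia F, ∀ c ∈ C, ρ σ c = c)
    (hDtriv : ∀ σ ∈ absInertia F, ∀ a : A, ρ σ a - a ∈ C)
    (hCdiv : ∀ c ∈ C, ∃ c' ∈ C, p • c' = c)
    (hAdiv : ∀ a : A, ∃ b : A, p • b = a)
    (hAprim : ∀ a : A, ∃ n : ℕ, p ^ n • a = 0)
    [Finite (Submodule.torsionBy ℤ A (p : ℤ))] [Finite (Submodule.torsionBy ℤ (A ⧸ C) (p : ℤ))]
    (hCp : Nat.card (Submodule.torsionBy ℤ C (p : ℤ)) ≤ p)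
    (hmove : ∃ σ ∈ absInertia F, ∃ a : A, ρ σ a ≠ a)
    {φ g : absoluteGaloisGroup F} (hφ : IsFrobPow φ 1)
    (hg : MapClusterPt g atTop (fun k : ℕ => φ ^ p ^ k.factorial))
    (a : ℤ) (hga : ∀ d : A ⧸ C, (p : ℤ) • d = 0 → ρ.quotient C hC g d = a • d)
    (hcong : ¬ ((p : ℤ) ∣ (residueFieldCard F : ℤ) - a))
    (f : contOneCocycles (ρ.restrict (subgroupIncl (absInertia F))).toTopRep)
    (hpf : p • oneCocycleClass _ f = 0)
    (hinv : ∃ a₀ : A, ∀ σ : absInertia F,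
      ρ g (f.1 ⟨g⁻¹ * (σ : absoluteGaloisGroup F) * g,
        (inferInstance : (absInertia F).Normal).conj_mem' _ σ.2 g⟩) - f.1 σ =
        ρ (σ : absoluteGaloisGroup F) a₀ - a₀) :
    oneCocycleClass _ f = 0 := by
  haveI : CompactSpace (absoluteGaloisGroup F) := absoluteGaloisGroup_compactSpace F
  haveI : CompactSpace (absInertia F) :=
    isCompact_iff_compactSpace.mp (isClosed_absInertia_holds F).isCompact
  have hCI : ∀ g : absInertia F, C ≤ C.comap (ρ.restrict (subgroupIncl (absInertia F)) g) :=
    fun g => hC g.1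
  have hinj := cohomologyMap_mkQHom_one_injective F ρ C hC hpF hCtriv hDtriv hCdiv hAdiv hAprim hCp hmove
  -- evaluation of cocycles is additive
  have hev : ∀ (σ : absInertia F) (n : ℕ)
      (ψ : contOneCocycles (ρ.restrict (subgroupIncl (absInertia F))).toTopRep),
      (n • ψ).1 σ = n • ψ.1 σ := by
    intro σ n ψ
    induction n with
    | zero => rw [zero_nsmul, zero_nsmul]; rfl
    | succ n ih => rw [succ_nsmul, succ_nsmul, ← ih]; rfl
  -- `p • f` is principal
  obtain ⟨b, hb⟩ : ∃ b : A, ∀ σ : absInertia F,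
      p • f.1 σ = ρ (σ : absoluteGaloisGroup F) b - b := by
    rw [← oneCocycleClassₗ_apply, ← map_nsmul, oneCocycleClassₗ_apply, oneCocycleClass_eq_zero_iff]
      at hpf
    obtain ⟨b, hb⟩ := hpf
    exact ⟨b, fun σ => by rw [← hev]; exact hb σ⟩
  obtain ⟨a₀, ha₀⟩ := hinv
  -- the homomorphism `f̄ : I_F → (A/C)[p]`
  have hmkC : ∀ x : A, x ∈ C → C.mkQ x = 0 := fun x hx =>
    (LinearMap.mem_ker).1 (by rw [Submodule.ker_mkQ]; exact hx)
  let fb : absInertia F → Submodule.torsionBy ℤ (A ⧸ C) (p : ℤ) := fun σ =>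
    ⟨C.mkQ (f.1 σ), by
      rw [Submodule.mem_torsionBy_iff, Nat.cast_smul_eq_nsmul, ← map_nsmul, hb σ]
      exact hmkC _ (hDtriv _ σ.2 b)⟩
  have hfb : ∀ σ, ((fb σ : Submodule.torsionBy ℤ (A ⧸ C) (p : ℤ)) : A ⧸ C) = C.mkQ (f.1 σ) :=
    fun _ => rfl
  have hfb_mul : ∀ x y, fb (x * y) = fb x + fb y := fun x y => by
    apply Subtype.ext
    rw [Submodule.coe_add, hfb, hfb, hfb, f.2 x y, map_add]
    congr 1
    change C.mkQ (ρ (x : absoluteGaloisGroup F) (f.1 y)) = _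
    rw [← sub_eq_zero, ← map_sub]
    exact hmkC _ (hDtriv _ x.2 _)
  have hfb_cont : Continuous fb :=
    ((continuous_of_discreteTopology (f := C.mkQ)).comp f.1.continuous).subtype_mk _
  -- (1) `f̄(g τ g⁻¹) = q • f̄(τ)`
  have hB : (Nat.card (Submodule.torsionBy ℤ (A ⧸ C) (p : ℤ))).Coprime (ringChar 𝓀[F]) :=
    natCard_coprime_of_prime_nsmul_eq_zero (ringChar_residueField_prime (F := F)) hpF fun d =>
      Subtype.ext (by
        rw [AddSubmonoidClass.coe_nsmul, ZeroMemClass.coe_zero, ← Nat.cast_smul_eq_nsmul ℤ]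
        exact (Submodule.mem_torsionBy_iff _ _).1 d.2)
  have hpB : ∀ d : Submodule.torsionBy ℤ (A ⧸ C) (p : ℤ), p • d = 0 := fun d =>
    Subtype.ext (by
      rw [AddSubmonoidClass.coe_nsmul, ZeroMemClass.coe_zero, ← Nat.cast_smul_eq_nsmul ℤ]
      exact (Submodule.mem_torsionBy_iff _ _).1 d.2)
  have hconj := apply_conj_eq_card_nsmul_of_mapClusterPt F hB hpB fb hfb_mul hfb_cont hφ hg
  -- (2) invariance: `f̄(g τ g⁻¹) = ρ̄(g) f̄(τ) = a • f̄(τ)`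
  have hinv' : ∀ τ : absInertia F,
      ((fb ⟨g * τ * g⁻¹, (inferInstance : (absInertia F).Normal).conj_mem _ τ.2 g⟩ :
        Submodule.torsionBy ℤ (A ⧸ C) (p : ℤ)) : A ⧸ C) = a • ((fb τ : _) : A ⧸ C) := by
    intro τ
    have h := ha₀ ⟨g * τ * g⁻¹, (inferInstance : (absInertia F).Normal).conj_mem _ τ.2 g⟩
    have hτ : (⟨g⁻¹ * (g * (τ : absoluteGaloisGroup F) * g⁻¹) * g,
        (inferInstance : (absInertia F).Normal).conj_mem' _
          ((inferInstance : (absInertia F).Normal).conj_mem _ τ.2 g) g⟩ : absInertia F) = τ :=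
      Subtype.ext (by group)
    rw [hτ] at h
    have h1 : C.mkQ (ρ g (f.1 τ)) =
        C.mkQ (f.1 ⟨g * τ * g⁻¹, (inferInstance : (absInertia F).Normal).conj_mem _ τ.2 g⟩) := by
      rw [← sub_eq_zero, ← map_sub, h]
      exact hmkC _ (hDtriv _ ((inferInstance : (absInertia F).Normal).conj_mem _ τ.2 g) a₀)
    rw [hfb, hfb, ← h1, Submodule.mkQ_apply, Submodule.mkQ_apply,
      ← ContinuousRep.quotient_apply_mk ρ C hC g (f.1 τ)]
    exact hga _ ((Submodule.mem_torsionBy_iff _ _).1 (fb τ).2)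
  -- (3) `(q - a) • f̄ τ = 0 = p • f̄ τ`, `p ∤ q - a`, hence `f̄ = 0`
  have hcop : IsCoprime ((residueFieldCard F : ℤ) - a) (p : ℤ) := by
    rw [Int.isCoprime_iff_gcd_eq_one]
    rcases (Nat.dvd_prime hp.out).1 (Int.gcd_dvd_natAbs_right ((residueFieldCard F : ℤ) - a) (p : ℤ))
      with h | h
    · exact h
    · exfalso
      apply hcong
      have := Int.gcd_dvd_left ((residueFieldCard F : ℤ) - a) (p : ℤ)
      rw [h] at this
      exact this
  have hzero : ∀ τ : absInertia F, C.mkQ (f.1 τ) = 0 := by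
    intro τ
    set x : A ⧸ C := C.mkQ (f.1 τ) with hx
    have hq : ((residueFieldCard F : ℕ) : ℤ) • x = a • x := by
      rw [hx, ← hfb, ← hinv' τ, hconj τ, Submodule.coe_smul_of_tower, Nat.cast_smul_eq_nsmul]
    have hpx : (p : ℤ) • x = 0 := (Submodule.mem_torsionBy_iff _ _).1 (fb τ).2
    have hqa : ((residueFieldCard F : ℤ) - a) • x = 0 := by rw [sub_smul, hq, sub_self]
    obtain ⟨u, w, huw⟩ := hcop
    calc x = (1 : ℤ) • x := (one_smul ℤ x).symm
      _ = (u * ((residueFieldCard F : ℤ) - a) + w * (p : ℤ)) • x := by rw [huw]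
      _ = 0 := by rw [add_smul, mul_smul, mul_smul, hqa, hpx, zsmul_zero, zsmul_zero, add_zero]
  -- (4) the image of `[f]` in `H¹(I, A/C)` vanishes, hence `[f] = 0` (§2)
  have hmap : cohomologyMap ((ρ.restrict (subgroupIncl (absInertia F))).mkQHom C hCI) 1
      (oneCocycleClass _ f) = 0 := by
    rw [cohomologyMap_oneCocycleClass, oneCocycleClass_eq_zero_iff]
    refine ⟨0, fun σ => ?_⟩
    rw [map_zero, sub_zero, pullback_id_resIdHom_apply, ContinuousRep.mkQHom_hom_apply,
      ← Submodule.mkQ_apply]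
    exact hzero σ
  exact hinj (hmap.trans (map_zero _).symm)

end Abstract

end Summit.BirchSwinnertonDyer.Rank1Residual.X2.LocalInertiaTateQuotient

end
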